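import Mathlib
import Summits.KontsevichZagierPeriods.Zeta5Search.BrickHatStrip
import Summits.KontsevichZagierPeriods.Zeta5Search.BrickLambdaCirc
import Summits.KontsevichZagierPeriods.Zeta5Search.AperyOffDigitBinomials

/-!
# BrickHatLambda — zi-p2's THEOREM 9 LEMMA 9.2 (i), valuation half: the multiplier of an off-digit cell has
`v_p(Λ_K) = A` EXACTLY (`Λ_K = c_{K,A}(np)/ĉ_{j,A}(n)`; here `a = n^{A−2B}Λ_K` with `v(a) = exp(−A)·v(n)^{A−2B}`)
(cell zeta5-irr)

HONEST FRAMING: systematic search; no irrationality claim unless certified. INSTRUMENT lemma of the ζ(5)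
census cell zeta5-irr (HOME `run/shared/lean/pub/zeta5-irr/`; memo `zi-p2/probes/B8/thm9/THEOREM9.md` LEMMA 9.2 (i)
«Legendre one step with N = np …: C(np,K) = p·(n−j)C(n,j)·ρ₁°, C(np+K,K) = C(n+j,j)ρ₂°, C(2np−K,np) = C(2n−1−j,n)ρ₃° …
Λ_K = p^A((np−2K)/2)Ξ_K»). Nothing here is about ζ(5); no irrationality content; filing moves no rung. Filed by the
engine seat zi-eng (g9); inputs `AperyOffDigitBinomials.padicValNat_choose_offDigit/_shift_offDigit` (zi-eng g6),
`BlockRatioBinomial.padicValNat_choose_block` (g7), `BrickHatStrip.laurentSeries_rescale_eq_hat` (g9).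

## The statements (`p` odd prime, `2B ≤ A`, `n = m+1`, `K = i + jp`, `1 ≤ i < p`, `j ≤ m`)

* `choose_mul_succ_hat`, `choose_add_mul_succ_hat`, `choose_two_sub_mul_succ_hat`: `(n−j)C(n,j) = n·C(m,j)`,
  `C(n+j,j)·n = C(m+j,j)·(n+j)`, `C(2n−1−j,n)·n = C(2m−j,m)·(2n−1−j)`.
* `padicValuation_cTop_hat`: `v(c_{K,A}(np))·v(n)^{2B} = exp(−A)·v(n)^A·v(Ê_j(0))·v(c̃_{j,A}(m))`.
* **`padicValuation_hatConst`**: the constant `a` of `laurentSeries_rescale_eq_hat` satisfies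
  `v(a)·v(n)^{2B} = exp(−A)·v(n)^A`, i.e. `v_p(a) = A + (A−2B)v_p(n)` (`= v_p(n^{A−2B}Λ_K)`, `v_p(Λ_K) = A`).
-/

namespace Summit.KontsevichZagierPeriods.Zeta5Search.BrickHatLambda

open Finset Nat Polynomial WithZero
open Summit.KontsevichZagierPeriods.Zeta5Search.BrickTopCoefficient (cTop)
open Summit.KontsevichZagierPeriods.Zeta5Search.BrickLaurent (laurent laurent_zero)
open Summit.KontsevichZagierPeriods.Zeta5Search.BrickLaurentValuation (padicValuation_natCast)
open Summit.KontsevichZagierPeriods.Zeta5Search.BlockRatioBinomial (padicValNat_choose_block)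
open Summit.KontsevichZagierPeriods.Zeta5Search.OffDigitBinomials (padicValNat_choose_offDigit
  padicValNat_choose_shift_offDigit)
open Summit.KontsevichZagierPeriods.Zeta5Search.BrickLambda (cTop_zero_ne_zero)
open Summit.KontsevichZagierPeriods.Zeta5Search.BrickLambdaCirc (padicValuation_cTop_eq padicValuation_centre_eq_one)
open Summit.KontsevichZagierPeriods.Zeta5Search.BrickHatStrip (hatPoly hatPoly_eval_zero_ne_zero)

noncomputable section

variable {p : ℕ} [Fact p.Prime]

/-! ## The three binomials of the hat kernel against those of `R̃_{n−1}` -/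

omit [Fact p.Prime] in
/-- `(n−j)·C(n,j) = n·C(m,j)` for `n = m+1`. -/
theorem choose_mul_succ_hat (m j : ℕ) : (m + 1 - j) * (m + 1).choose j = (m + 1) * m.choose j := by
  rw [mul_comm (m + 1 - j), mul_comm (m + 1)]
  exact (Nat.choose_mul_succ_eq m j).symm

omit [Fact p.Prime] in
/-- `C(n+j,j)·n = C(m+j,j)·(n+j)` for `n = m+1`. -/
theorem choose_add_mul_succ_hat (m j : ℕ) : (m + 1 + j).choose j * (m + 1) = (m + j).choose j * (m + j + 1) := by
  have h := Nat.choose_mul_succ_eq (m + j) j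
  rw [show m + j + 1 - j = m + 1 by omega, show m + j + 1 = m + 1 + j by ring] at h
  rw [show m + j + 1 = m + 1 + j by ring]
  exact h.symm

omit [Fact p.Prime] in
/-- `C(2n−1−j,n)·n = C(2m−j,m)·(2n−1−j)` for `n = m+1`, `j ≤ m`. -/
theorem choose_two_sub_mul_succ_hat {m j : ℕ} (hj : j ≤ m) :
    (2 * m + 1 - j).choose (m + 1) * (m + 1) = (2 * m - j).choose m * (2 * m + 1 - j) := by
  have h := Nat.add_one_mul_choose_eq (2 * m - j) m
  rw [show 2 * m + 1 - j = 2 * m - j + 1 by omega, mul_comm ((2 * m - j).choose m)]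
  exact h.symm

section hat

variable (hp2 : p ≠ 2) {A B m j i : ℕ} (hAB : 2 * B ≤ A) (hi1 : 1 ≤ i) (hip : i < p) (hj : j ≤ m)
include hp2 hi1 hip hj

omit hp2 hj in
/-- `p ∤ np − 2K` for an off-digit cell (odd `p`). -/
theorem not_dvd_centre_hat (hp2 : p ≠ 2) : ¬ (p : ℤ) ∣ (((m + 1) * p : ℕ) : ℤ) - 2 * (i + j * p : ℕ) := by
  have hp : p.Prime := Fact.out
  rintro ⟨c, hc⟩
  have h2i : (p : ℤ) ∣ 2 * (i : ℤ) := ⟨(m + 1 : ℤ) - 2 * j - c, by push_cast at hc ⊢; linarith⟩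
  have hpi : (p : ℤ) ∣ (i : ℤ) := by
    refine (Int.Prime.dvd_mul' hp h2i).resolve_left fun h => hp2 ?_
    exact (Nat.prime_dvd_prime_iff_eq hp Nat.prime_two).1 (by exact_mod_cast h)
  have hpi' : p ∣ i := by exact_mod_cast hpi
  have hle : p ≤ i := Nat.le_of_dvd (by omega) hpi'
  omega

/-- **LEMMA 9.2 (i), valuation form**: `v(c_{K,A}(np))·v(n)^{2B} = exp(−A)·v(n)^A·v(Ê_j(0))·v(c̃_{j,A}(m))`
(`K = i + jp` off-digit, `n = m+1`). -/
theorem padicValuation_cTop_hat :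
    Rat.padicValuation p (cTop A B 1 ((m + 1) * p) (i + j * p)) * Rat.padicValuation p (((m + 1 : ℕ) : ℚ)) ^ (2 * B) =
      exp (-(A : ℤ)) * Rat.padicValuation p (((m + 1 : ℕ) : ℚ)) ^ A *
        Rat.padicValuation p ((hatPoly B m j).eval 0) * Rat.padicValuation p (cTop A B 0 m j) := by
  have hp : p.Prime := Fact.out
  have hjp : j * p ≤ m * p := Nat.mul_le_mul_right _ hj
  have e2 : (m + 1) * p = m * p + p := by ring
  -- the three binomial valuations (Kummer one step)
  have hX : padicValNat p (((m + 1) * p).choose (i + j * p)) = 1 + padicValNat p ((m + 1) * m.choose j) := by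
    rw [show i + j * p = j * p + i by ring, padicValNat_choose_offDigit hp (by omega) hi1 hip, choose_mul_succ_hat]
  have hY : padicValNat p (((m + 1) * p + (i + j * p)).choose (i + j * p)) + padicValNat p (m + 1) =
      padicValNat p ((m + j).choose j) + padicValNat p (m + j + 1) := by
    rw [show (m + 1) * p + (i + j * p) = ((m + 1) + j) * p + i by ring, show i + j * p = j * p + i by ring,
      padicValNat_choose_shift_offDigit hp (m + 1) j hip, ← padicValNat.mul (Nat.choose_pos (by omega)).ne' (by omega),
      choose_add_mul_succ_hat, padicValNat.mul (Nat.choose_pos (by omega)).ne' (by omega)]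
  have hZ : padicValNat p ((2 * ((m + 1) * p) - (i + j * p)).choose ((m + 1) * p)) + padicValNat p (m + 1) =
      padicValNat p ((2 * m - j).choose m) + padicValNat p (2 * m + 1 - j) := by
    have e : 2 * ((m + 1) * p) - (i + j * p) = ((m + 1) + (m - j)) * p + (0 + (p - i)) := by
      zify [hj, hip.le, show i + j * p ≤ 2 * ((m + 1) * p) by omega]
      ring
    rw [e, show (m + 1) * p = (m + 1) * p + 0 by ring, padicValNat_choose_block hp (m + 1) (m - j) (by omega),
      show m + 1 + (m - j) = 2 * m + 1 - j by omega,
      ← padicValNat.mul (Nat.choose_pos (by omega)).ne' (by omega), choose_two_sub_mul_succ_hat hj,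
      padicValNat.mul (Nat.choose_pos (by omega)).ne' (by omega)]
  -- translate to valuations
  have vn : Rat.padicValuation p (((m + 1 : ℕ) : ℚ)) = exp (-(padicValNat p (m + 1) : ℤ)) := padicValuation_natCast (by omega)
  have hE : (hatPoly B m j).eval 0 = (-(((m + j + 1 : ℕ) : ℚ))) ^ B * (((2 * m + 1 - j : ℕ) : ℚ)) ^ B := by
    unfold hatPoly
    simp only [eval_mul, eval_pow, eval_add, eval_X, eval_C, zero_add]
    congr 2
    · push_cast; ring
    · push_cast [show j ≤ 2 * m + 1 by omega]; ring
  rw [padicValuation_cTop_eq, padicValuation_cTop_eq, pow_one, pow_zero, one_mul,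
    padicValuation_centre_eq_one hp2 (not_dvd_centre_hat hi1 hip hp2), one_mul, hE, map_mul, map_pow, map_pow,
    Valuation.map_neg,
    padicValuation_natCast (Nat.choose_pos (by omega)).ne', padicValuation_natCast (Nat.choose_pos (Nat.le_add_left _ _)).ne',
    padicValuation_natCast (Nat.choose_pos (by omega)).ne', padicValuation_natCast (Nat.choose_pos hj).ne',
    padicValuation_natCast (Nat.choose_pos (Nat.le_add_left _ _)).ne', padicValuation_natCast (Nat.choose_pos (by omega)).ne',
    padicValuation_natCast (show m + j + 1 ≠ 0 by omega), padicValuation_natCast (show 2 * m + 1 - j ≠ 0 by omega), vn,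
    hX, padicValNat.mul (by omega) (Nat.choose_pos hj).ne']
  simp only [← exp_nsmul, ← exp_add, nsmul_eq_mul]
  congr 1
  have hY' : ((padicValNat p (((m + 1) * p + (i + j * p)).choose (i + j * p)) : ℕ) : ℤ) =
      (padicValNat p ((m + j).choose j) : ℤ) + (padicValNat p (m + j + 1) : ℤ) - (padicValNat p (m + 1) : ℤ) := by
    omega
  have hZ' : ((padicValNat p ((2 * ((m + 1) * p) - (i + j * p)).choose ((m + 1) * p)) : ℕ) : ℤ) =
      (padicValNat p ((2 * m - j).choose m) : ℤ) + (padicValNat p (2 * m + 1 - j) : ℤ) - (padicValNat p (m + 1) : ℤ) := by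
    omega
  simp only [Nat.cast_add, Nat.cast_mul, Nat.cast_one, Nat.cast_ofNat, hY', hZ']
  ring

include hAB in
/-- **The hat constant has `v_p(a) = A + (A−2B)·v_p(n)`**: for the `a` of `BrickHatStrip.laurentSeries_rescale_eq_hat`
(`a·Ê_j(0)·laurent A B 0 m j 0 = laurent A B 1 (np) K 0`): `v(a)·v(n)^{2B} = exp(−A)·v(n)^A` — zi-p2's `Λ_K = a/n^{A−2B}`
has `v_p(Λ_K) = A` exactly. -/
theorem padicValuation_hatConst {a : ℚ}
    (ha : a * (hatPoly B m j).eval 0 * laurent A B 0 m j 0 = laurent A B 1 ((m + 1) * p) (i + j * p) 0) :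
    Rat.padicValuation p a * Rat.padicValuation p (((m + 1 : ℕ) : ℚ)) ^ (2 * B) =
      exp (-(A : ℤ)) * Rat.padicValuation p (((m + 1 : ℕ) : ℚ)) ^ A := by
  have hK : i + j * p ≤ (m + 1) * p := by nlinarith
  rw [laurent_zero hAB 0 hj, laurent_zero hAB 1 hK] at ha
  have hE0 := hatPoly_eval_zero_ne_zero B hj
  have hT0 : cTop A B 0 m j ≠ 0 := cTop_zero_ne_zero hj A B
  have hv := congrArg (fun x => Rat.padicValuation p x * Rat.padicValuation p (((m + 1 : ℕ) : ℚ)) ^ (2 * B)) ha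
  simp only [map_mul] at hv
  rw [padicValuation_cTop_hat hp2 hi1 hip hj] at hv
  have hne : Rat.padicValuation p ((hatPoly B m j).eval 0) * Rat.padicValuation p (cTop A B 0 m j) ≠ 0 :=
    mul_ne_zero ((Valuation.ne_zero_iff _).2 hE0) ((Valuation.ne_zero_iff _).2 hT0)
  apply mul_right_cancel₀ hne
  calc Rat.padicValuation p a * Rat.padicValuation p (((m + 1 : ℕ) : ℚ)) ^ (2 * B) *
        (Rat.padicValuation p ((hatPoly B m j).eval 0) * Rat.padicValuation p (cTop A B 0 m j))
      = Rat.padicValuation p a * Rat.padicValuation p ((hatPoly B m j).eval 0) *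
          Rat.padicValuation p (cTop A B 0 m j) * Rat.padicValuation p (((m + 1 : ℕ) : ℚ)) ^ (2 * B) := by
        simp only [mul_comm, mul_assoc, mul_left_comm]
    _ = _ := by rw [hv]; simp only [mul_comm, mul_assoc, mul_left_comm]

end hat

end

end Summit.KontsevichZagierPeriods.Zeta5Search.BrickHatLambda
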